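import Mathlib
import Summits.MatrixMultiplication.MatrixMultiplication.Theses.LevelGradedCohnUmans
import Literature.Barriers.MatrixMultiplication.NormalizerBarrier
import Literature.Analysis.Fourier.FiniteUncertaintyPrincipleProofs

/-!
# Sketch — crux `SubgroupIdentityDesigns` (stmt-MatrixMultiplication-14079), crux-ideate r1, ideator 1

First lemmas for the idea cards of this seat.

* `graded_normalizer_count` (PROVED): the GRADED lift of BCGPU 2023 Thm 3.6 — for a bi-invariant
  test space `J`, a subgroup-TPP triple passing the `J`-identity test, and any subgroup `N ≤ H₂`
  normalising `H₃`, one has `|H₁|·|N|·|H₃| ≤ dim J` (the paper's bound has `|G|` on the right).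
  With `N = H₂` (`volume_le_finrank_of_middle_normalizes`): if the middle group normalises an
  outer group, the VOLUME is at most `dim J` — which kills the Borel template of card
  `borel-configuration-identity-test` (there `H₂ ≤ N_G(H₃)`, `V ≈ W^{3/2}/p ≫ W = dim F_k`) and every
  configuration `(U⁻, T', U⁺)` with a split toral middle.
* `volume_le_card_rankLE_of_middle_normalizes` (PROVED): the same for the crux's inline level-`k`
  Fourier test space, with the explicit bound `N_k = #{M : rk M ≤ k}`.
* `sandwich_criterion_GL2` (statement; proof = isotypic reduction along `U⁻ × U⁺` + the tree's
  Chebotarev lemma `Literature.Analysis.Fourier.det_dftMinor_ne_zero`): anisotropic middles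
  `(U⁻, H₂, U⁺)` in `GL_2(𝔽_p)` pass the level-1 identity test as soon as `H₂ ⊂ SL_2` lies in the
  big cell and shows at most `(p-1)/2` distinct `(1,1)`-entries.
* `AnisotropicSiegelFamily` (Prop, the crux-level transfer target of card anisotropic-siegel-sandwich).
-/

set_option linter.dupNamespace false
set_option linter.unusedSectionVars false

noncomputable section

open scoped BigOperators
open Literature.Barriers.MatrixMultiplication

namespace Summit.MatrixMultiplication.MatrixMultiplication.Cruxes.SubgroupIdentityDesigns.Ideator1

/-! ## Abstract graded normaliser count -/

section Abstract

variable {G : Type} [Group G] [Fintype G] [DecidableEq G]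

/-- The `J`-identity test of a subgroup triple: ONE test function equal to `[g = 1]` on `H₁H₂H₃`
(the crux's clause, for an abstract test space). -/
def IdentityTest (J : Set (G → ℂ)) (H₁ H₂ H₃ : Subgroup G) : Prop :=
  ∃ f ∈ J, f 1 = 1 ∧ ∀ a ∈ H₁, ∀ b ∈ H₂, ∀ c ∈ H₃, a * b * c ≠ 1 → f (a * b * c) = 0

/-- Two-sided translation `f ↦ (g ↦ f (a g b))` as a linear map. -/
def transl (a b : G) : (G → ℂ) →ₗ[ℂ] (G → ℂ) where
  toFun f := fun g => f (a * g * b)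
  map_add' f f' := by ext g; simp
  map_smul' c f := by ext g; simp

@[simp] theorem transl_apply (a b : G) (f : G → ℂ) (g : G) : transl a b f g = f (a * g * b) := rfl

/-- **Graded normaliser count.**  Let `J` be a bi-invariant space of test functions on a finite
group `G`, `(H₁, H₂, H₃)` a subgroup-TPP triple passing the `J`-identity test, and `N ≤ H₂` a
subgroup normalising `H₃`.  Then the functions `g ↦ f(a⁻¹ · g · c⁻¹ b⁻¹)`, `(a, b, c) ∈ H₁ × N × H₃`,
lie in `J` and restrict to the distinct delta functions `δ_{abc}` on `H₁ N H₃`, hence are linearly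
independent: `|H₁| · |N| · |H₃| ≤ dim J`.  (BCGPU 2023 Thm 3.6 is the case `J = ℂ^G`.) -/
theorem graded_normalizer_count (J : Submodule ℂ (G → ℂ))
    (hJ : ∀ f ∈ J, ∀ a b : G, (fun g : G => f (a * g * b)) ∈ J)
    (H₁ H₂ H₃ : Subgroup G) (htpp : SubgroupTPP H₁ H₂ H₃)
    (N : Subgroup G) (hN : N ≤ H₂) (hnorm : ∀ b ∈ N, ∀ c ∈ H₃, b * c * b⁻¹ ∈ H₃)
    (hid : IdentityTest (J : Set (G → ℂ)) H₁ H₂ H₃) :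
    Nat.card H₁ * Nat.card N * Nat.card H₃ ≤ Module.finrank ℂ J := by
  classical
  obtain ⟨f, hfJ, hf1, hf0⟩ := hid
  -- the family of translates, indexed by triples
  let ι := H₁ × N × H₃
  let F : ι → (G → ℂ) := fun t => fun g => f ((t.1 : G)⁻¹ * g * ((t.2.2 : G)⁻¹ * (t.2.1 : G)⁻¹))
  have hF_mem : ∀ t : ι, F t ∈ J := fun t => hJ f hfJ _ _
  -- value of `F t` at a product `a' b' c'`
  have hval : ∀ (t t' : ι),
      F t ((t'.1 : G) * (t'.2.1 : G) * (t'.2.2 : G)) = if t' = t then 1 else 0 := by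
    rintro ⟨a, b, c⟩ ⟨a', b', c'⟩
    simp only [F]
    -- regroup:  a⁻¹ (a' b' c') (c⁻¹ b⁻¹) = (a⁻¹a') (b' b⁻¹) (b c' c⁻¹ b⁻¹)
    have hre : (a : G)⁻¹ * ((a' : G) * (b' : G) * (c' : G)) * ((c : G)⁻¹ * (b : G)⁻¹)
        = ((a : G)⁻¹ * a') * ((b' : G) * (b : G)⁻¹) * ((b : G) * ((c' : G) * (c : G)⁻¹) * (b : G)⁻¹) := by
      group
    rw [hre]
    have h1 : (a : G)⁻¹ * a' ∈ H₁ := H₁.mul_mem (H₁.inv_mem a.2) a'.2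
    have h2 : (b' : G) * (b : G)⁻¹ ∈ H₂ := H₂.mul_mem (hN b'.2) (H₂.inv_mem (hN b.2))
    have h3 : (b : G) * ((c' : G) * (c : G)⁻¹) * (b : G)⁻¹ ∈ H₃ :=
      hnorm b b.2 _ (H₃.mul_mem c'.2 (H₃.inv_mem c.2))
    by_cases heq : ((a : G)⁻¹ * a') * ((b' : G) * (b : G)⁻¹) * ((b : G) * ((c' : G) * (c : G)⁻¹) * (b : G)⁻¹) = 1
    · obtain ⟨e1, e2, e3⟩ := htpp _ h1 _ h2 _ h3 heq
      have ea : a' = a := by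
        apply Subtype.ext
        have := e1; rw [inv_mul_eq_one] at this; exact this.symm
      have eb : b' = b := by
        apply Subtype.ext
        exact mul_inv_eq_one.mp e2
      have ec : c' = c := by
        apply Subtype.ext
        have h' : (c' : G) * (c : G)⁻¹ = 1 := by
          have := e3
          rwa [mul_inv_eq_one, mul_eq_left] at this
        exact mul_inv_eq_one.mp h'
      rw [heq, hf1, if_pos]
      rw [ea, eb, ec]
    · rw [hf0 _ h1 _ h2 _ h3 heq, if_neg]
      rintro ⟨rfl⟩
      apply heq
      group
  -- linear independence in `J`
  let F' : ι → J := fun t => ⟨F t, hF_mem t⟩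
  have hli : LinearIndependent ℂ F' := by
    rw [Fintype.linearIndependent_iff]
    intro g hg t
    -- evaluate the relation at the product of `t`
    have := congrArg (fun (φ : J) => (φ : G → ℂ) ((t.1 : G) * (t.2.1 : G) * (t.2.2 : G))) hg
    simp only [Submodule.coe_sum, Submodule.coe_smul, Finset.sum_apply, Pi.smul_apply,
      smul_eq_mul, Submodule.coe_zero, Pi.zero_apply, F'] at this
    simp_rw [hval] at this
    simp_rw [mul_ite, mul_one, mul_zero] at this
    rw [Finset.sum_ite_eq] at this
    simpa using this
  have hcard := hli.fintype_card_le_finrank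
  simpa [ι, Fintype.card_prod, Nat.card_eq_fintype_card, mul_assoc] using hcard

/-- **If the middle group normalises an outer group, the volume is at most `dim J`.**
(`N = H₂` in `graded_normalizer_count`.)  Kills the Borel template: there
`H₂ = S₂ ⋉ U⁺_{rows k+1..2k} ≤ N_G(S₃ ⋉ U⁺_{rows 1..k})`, while `V ≈ (dim F_k)^{3/2}/p`. -/
theorem volume_le_finrank_of_middle_normalizes (J : Submodule ℂ (G → ℂ))
    (hJ : ∀ f ∈ J, ∀ a b : G, (fun g : G => f (a * g * b)) ∈ J)
    (H₁ H₂ H₃ : Subgroup G) (htpp : SubgroupTPP H₁ H₂ H₃)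
    (hnorm : ∀ b ∈ H₂, ∀ c ∈ H₃, b * c * b⁻¹ ∈ H₃)
    (hid : IdentityTest (J : Set (G → ℂ)) H₁ H₂ H₃) :
    Nat.card H₁ * Nat.card H₂ * Nat.card H₃ ≤ Module.finrank ℂ J :=
  graded_normalizer_count J hJ H₁ H₂ H₃ htpp H₂ le_rfl hnorm hid

end Abstract


/-! ## The crux's level-`k` Fourier test space -/

section Crux

/-- `GL_m(𝔽_p)` as in the crux. -/
abbrev GLp (m p : ℕ) := Matrix.GeneralLinearGroup (Fin m) (ZMod p)
/-- `M_m(𝔽_p)`. -/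
abbrev Mat (m p : ℕ) := Matrix (Fin m) (Fin m) (ZMod p)

variable {m p : ℕ} [Fact p.Prime]

/-- The Fourier character `g ↦ ψ(tr(M g))` of the crux (`ψ = ZMod.stdAddChar`). -/
def fourierChar (M : Mat m p) : GLp m p → ℂ :=
  fun g => ZMod.stdAddChar (Matrix.trace (M * (g : Mat m p)))

/-- The level-`k` test space `F_k|_G` as a submodule: the span of the characters of rank `≤ k`. -/
def levelSpan (p m k : ℕ) [Fact p.Prime] : Submodule ℂ (GLp m p → ℂ) :=
  Submodule.span ℂ (Set.range fun M : {M : Mat m p // M.rank ≤ k} => fourierChar M.1)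

/-- A rank-supported Fourier sum (the crux's test functions) lies in `levelSpan`. -/
theorem sum_mem_levelSpan {k : ℕ} (c : Mat m p → ℂ) (hc : ∀ M, k < M.rank → c M = 0) :
    (fun g : GLp m p => ∑ M : Mat m p,
      c M * ZMod.stdAddChar (Matrix.trace (M * (g : Mat m p)))) ∈ levelSpan p m k := by
  have hfun : (fun g : GLp m p => ∑ M : Mat m p,
      c M * ZMod.stdAddChar (Matrix.trace (M * (g : Mat m p)))) = ∑ M : Mat m p, c M • fourierChar M := by
    ext g
    simp [fourierChar, Finset.sum_apply]
  rw [hfun]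
  refine Submodule.sum_mem _ fun M _ => ?_
  by_cases hM : M.rank ≤ k
  · exact Submodule.smul_mem _ _ (Submodule.subset_span ⟨⟨M, hM⟩, rfl⟩)
  · rw [hc M (lt_of_not_ge hM), zero_smul]
    exact Submodule.zero_mem _

/-- Translating a Fourier character gives the Fourier character of `b M a`. -/
theorem fourierChar_transl (M : Mat m p) (a b g : GLp m p) :
    fourierChar M (a * g * b) = fourierChar ((b : Mat m p) * M * (a : Mat m p)) g := by
  simp only [fourierChar, Units.val_mul]
  have htr : Matrix.trace (M * ((a : Mat m p) * (g : Mat m p) * (b : Mat m p))) =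
      Matrix.trace ((b : Mat m p) * M * (a : Mat m p) * (g : Mat m p)) := by
    rw [show M * ((a : Mat m p) * (g : Mat m p) * (b : Mat m p)) = (M * a * g) * (b : Mat m p) by
          simp only [Matrix.mul_assoc],
      Matrix.trace_mul_comm, ← Matrix.mul_assoc, ← Matrix.mul_assoc]
  rw [htr]

/-- Two-sided multiplication by units preserves the rank. [folklore] -/
theorem rank_units_mul (M : Mat m p) (a b : GLp m p) :
    ((b : Mat m p) * M * (a : Mat m p)).rank = M.rank := by
  have ha : IsUnit (a : Mat m p).det := (Matrix.isUnit_iff_isUnit_det _).mp (Units.isUnit _)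
  have hb : IsUnit (b : Mat m p).det := (Matrix.isUnit_iff_isUnit_det _).mp (Units.isUnit _)
  rw [Matrix.rank_mul_eq_left_of_isUnit_det _ _ ha, Matrix.rank_mul_eq_right_of_isUnit_det _ _ hb]

/-- **`F_k` is bi-invariant** (as a submodule). -/
theorem levelSpan_transl {k : ℕ} {f : GLp m p → ℂ} (hf : f ∈ levelSpan p m k) (a b : GLp m p) :
    (fun g : GLp m p => f (a * g * b)) ∈ levelSpan p m k := by
  have hmap : (levelSpan p m k).map (transl a b) ≤ levelSpan p m k := by
    rw [levelSpan, Submodule.map_span_le]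
    rintro _ ⟨⟨M, hM⟩, rfl⟩
    have h : transl a b (fourierChar M) = fourierChar ((b : Mat m p) * M * (a : Mat m p)) := by
      ext g; exact fourierChar_transl M a b g
    rw [h]
    exact Submodule.subset_span ⟨⟨(b : Mat m p) * M * (a : Mat m p), by rw [rank_units_mul]; exact hM⟩, rfl⟩
  exact hmap (Submodule.mem_map_of_mem hf)

/-- `dim F_k|_G ≤ N_k = #{M : rk M ≤ k}`. -/
theorem finrank_levelSpan_le (k : ℕ) :
    Module.finrank ℂ (levelSpan p m k) ≤ Nat.card {M : Mat m p // M.rank ≤ k} := by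
  classical
  rw [Nat.card_eq_fintype_card]
  exact finrank_range_le_card _

/-- **Graded normaliser count for the crux's test space.**  If a subgroup-TPP triple
`H₁, H₂, H₃ ≤ GL_m(𝔽_p)` passes the crux's level-`k` identity test (the two clauses of
`SubgroupIdentityDesigns`, verbatim) and the middle group normalises the third, then
`|H₁| |H₂| |H₃| ≤ N_k`.  For the Borel template of card `borel-configuration-identity-test`
(`H₂ = S₂ ⋉ U⁺_{rows k+1..2k}` normalises `H₃ = S₃ ⋉ U⁺_{rows 1..k}`) this contradicts
`V ≈ N_k^{3/2}/p`: the template fails the identity test for every `k, m, p`. -/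
theorem volume_le_card_rankLE_of_middle_normalizes (k : ℕ) (H₁ H₂ H₃ : Subgroup (GLp m p))
    (htpp : SubgroupTPP H₁ H₂ H₃) (hnorm : ∀ b ∈ H₂, ∀ c ∈ H₃, b * c * b⁻¹ ∈ H₃)
    (hid : ∃ c : Mat m p → ℂ, (∀ M, k < M.rank → c M = 0) ∧
      (∑ M : Mat m p, c M * ZMod.stdAddChar (Matrix.trace (M * ((1 : GLp m p) : Mat m p)))) = 1 ∧
      ∀ a ∈ H₁, ∀ b ∈ H₂, ∀ g ∈ H₃, a * b * g ≠ 1 →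
        (∑ M : Mat m p, c M * ZMod.stdAddChar (Matrix.trace (M * ((a * b * g : GLp m p) : Mat m p)))) = 0) :
    Nat.card H₁ * Nat.card H₂ * Nat.card H₃ ≤ Nat.card {M : Mat m p // M.rank ≤ k} := by
  classical
  obtain ⟨c, hc, h1, h0⟩ := hid
  refine le_trans ?_ (finrank_levelSpan_le (p := p) (m := m) k)
  refine volume_le_finrank_of_middle_normalizes (levelSpan p m k) (fun f hf a b => levelSpan_transl hf a b)
    H₁ H₂ H₃ htpp hnorm ⟨_, sum_mem_levelSpan c hc, h1, h0⟩

/-- The general form: any subgroup `N ≤ H₂` normalising `H₃` is charged, `|H₁| |N| |H₃| ≤ N_k`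
(graded BCGPU 2023 Thm 3.6).  E.g. a torus `S₂ ≤ H₂` normalising a pattern group `H₃` costs its
full order; `(U⁻, T, U⁺)` fails at every level `k < m`. -/
theorem card_mul_card_normalizer_mul_card_le (k : ℕ) (H₁ H₂ H₃ : Subgroup (GLp m p))
    (htpp : SubgroupTPP H₁ H₂ H₃) (N : Subgroup (GLp m p)) (hN : N ≤ H₂)
    (hnorm : ∀ b ∈ N, ∀ c ∈ H₃, b * c * b⁻¹ ∈ H₃)
    (hid : ∃ c : Mat m p → ℂ, (∀ M, k < M.rank → c M = 0) ∧
      (∑ M : Mat m p, c M * ZMod.stdAddChar (Matrix.trace (M * ((1 : GLp m p) : Mat m p)))) = 1 ∧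
      ∀ a ∈ H₁, ∀ b ∈ H₂, ∀ g ∈ H₃, a * b * g ≠ 1 →
        (∑ M : Mat m p, c M * ZMod.stdAddChar (Matrix.trace (M * ((a * b * g : GLp m p) : Mat m p)))) = 0) :
    Nat.card H₁ * Nat.card N * Nat.card H₃ ≤ Nat.card {M : Mat m p // M.rank ≤ k} := by
  classical
  obtain ⟨c, hc, h1, h0⟩ := hid
  refine le_trans ?_ (finrank_levelSpan_le (p := p) (m := m) k)
  exact graded_normalizer_count (levelSpan p m k) (fun f hf a b => levelSpan_transl hf a b)
    H₁ H₂ H₃ htpp N hN hnorm ⟨_, sum_mem_levelSpan c hc, h1, h0⟩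

end Crux

/-! ## Card `anisotropic-middle-sandwich`: the GL₂ miniature and the Siegel-type family -/

section Sandwich

variable {p : ℕ} [Fact p.Prime]

/-- The crux's level-`k` identity-test clause for a subgroup triple, verbatim. -/
def CruxIdTest (p m k : ℕ) [Fact p.Prime] (H₁ H₂ H₃ : Subgroup (GLp m p)) : Prop :=
  ∃ c : Mat m p → ℂ, (∀ M, k < M.rank → c M = 0) ∧
    (∑ M : Mat m p, c M * ZMod.stdAddChar (Matrix.trace (M * ((1 : GLp m p) : Mat m p)))) = 1 ∧
    ∀ a ∈ H₁, ∀ b ∈ H₂, ∀ g ∈ H₃, a * b * g ≠ 1 →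
      (∑ M : Mat m p, c M * ZMod.stdAddChar (Matrix.trace (M * ((a * b * g : GLp m p) : Mat m p)))) = 0

/-- **Sandwich criterion in `GL_2(𝔽_p)` (FIRST LEMMA of card `anisotropic-middle-sandwich`).**
`H₁ = U⁻`, `H₃ = U⁺` (pinned by their entries and orders), `H₂ ≤ SL_2(𝔽_p)` inside the big cell
(`b₁₁ ≠ 0`) showing at most `(p-1)/2` distinct `(1,1)`-entries, and subgroup TPP.  Then the
level-1 identity test holds.  Proof route: `S = H₁H₂H₃ = {g ∈ SL₂ : g₁₁ ∈ A}`, `A` = the set of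
`(1,1)`-entries; a level-1 ghost on `S` (a function with zero sums on every plane `{g : gu = v}`)
decomposes along the characters `(σ, τ)` of `U⁻ × U⁺`; for `στ ≠ 0` it is a vector `φ : A → ℂ`
killed by the DFT minor `(ψ(w a⁻¹))_{a ∈ A, w ∈ W_{σ,τ}}`, `W_{σ,τ} = {τ v - σ v⁻¹}` of size
`≥ (p-1)/2 ≥ |A|`, nonsingular by Chebotarev (`Literature.Analysis.Fourier.det_dftMinor_ne_zero`,
PROVED in tree); `σ = 0` or `τ = 0` ghosts vanish identically.  Covers every anisotropic middle
`C_d ≤` norm-one torus of `𝔽_{p²}`, `d ∣ p+1`, `d ≤ p-2`, `4 ∤ d` (kit j011796: p = 5, d = 3 PASS). -/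
theorem sandwich_criterion_GL2 (hp : 5 ≤ p) (H₁ H₂ H₃ : Subgroup (GLp 2 p))
    (h₁ : ∀ a ∈ H₁, (a : Mat 2 p) 0 0 = 1 ∧ (a : Mat 2 p) 1 1 = 1 ∧ (a : Mat 2 p) 0 1 = 0)
    (h₁c : Nat.card H₁ = p)
    (h₃ : ∀ c ∈ H₃, (c : Mat 2 p) 0 0 = 1 ∧ (c : Mat 2 p) 1 1 = 1 ∧ (c : Mat 2 p) 1 0 = 0)
    (h₃c : Nat.card H₃ = p)
    (hdet : ∀ b ∈ H₂, Matrix.det (b : Mat 2 p) = 1)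
    (hcell : ∀ b ∈ H₂, (b : Mat 2 p) 0 0 ≠ 0)
    (hfew : 2 * Set.ncard ((fun b : GLp 2 p => (b : Mat 2 p) 0 0) '' (H₂ : Set (GLp 2 p))) ≤ p - 1)
    (htpp : SubgroupTPP H₁ H₂ H₃) :
    CruxIdTest p 2 1 H₁ H₂ H₃ := by
  sorry

/-- The GL₂ MINIATURE as a closed statement: for every prime `p ≥ 5` and every `d ∣ p + 1` with
`d ≤ p - 2`, `4 ∤ d`, there is a subgroup-TPP triple of orders `(p, d, p)` in `GL_2(𝔽_p)`
(`U⁻`, the order-`d` subgroup of the norm-one torus of `𝔽_{p²}`, `U⁺`) passing the level-1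
identity test — the first subgroup designs with a non-trivial middle that normalises neither
outer group (volume `p²d` exceeds `|S| = p²(d+1)/2`). -/
def AnisotropicMiddleGL2 : Prop :=
  ∀ (p : ℕ) [Fact p.Prime], 5 ≤ p → ∀ d : ℕ, d ∣ p + 1 → d ≤ p - 2 → ¬ 4 ∣ d →
    ∃ H₁ H₂ H₃ : Subgroup (GLp 2 p), Nat.card H₁ = p ∧ Nat.card H₂ = d ∧ Nat.card H₃ = p ∧
      SubgroupTPP H₁ H₂ H₃ ∧ CruxIdTest p 2 1 H₁ H₂ H₃

/-- UNPROVED CLASSICAL INPUT (flagged): the level-`k` budget of `GL_m(𝔽_p)` grows like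
`p^{s(mk - k²/2 - k/2) + k}` — degrees of the Harish-Chandra series through `GL_j × GL_{m-j}`,
`j ≤ k` (Green 1955; Gurevich–Howe arXiv:1609.01276 Thm 21 for the leading term). -/
def LevelBudgetAsymptotics : Prop :=
  ∃ C : ℕ → ℝ, ∀ (k m p : ℕ) [Fact p.Prime] (s : ℝ), 2 * k ≤ m → 2 ≤ s → s ≤ 3 →
    (∑ᶠ χ ∈ Literature.RepresentationTheory.FiniteGroups.irrChars (GLp m p) ∩
        {f | ∃ c : Mat m p → ℂ, (∀ M, k < M.rank → c M = 0) ∧ ∀ g : GLp m p,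
          f g = ∑ M : Mat m p, c M * ZMod.stdAddChar (Matrix.trace (M * (g : Mat m p)))},
      (χ 1).re ^ s) ≤ (C k) ^ s * (p : ℝ) ^ (s * (m * k - (k : ℝ) ^ 2 / 2 - k / 2) + k)

/-- TRANSFER TARGET of card `anisotropic-middle-sandwich` (the critical ratio `m = 2k`): for
every `k ≥ 1` and unboundedly many `p`, a subgroup-TPP triple in `GL_{2k}(𝔽_p)` of volume
`≥ c_k p^{(9k² - 2)/2}` (all three level-`k` walls met up to one factor `p`) passing the level-`k`
identity test — intended witnesses `(U_P⁻ ⋊ (A₁ × 1), H₂ ≤ GL_k(𝔽_{p²}), U_P ⋊ (1 × A₃))`,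
`P` the Siegel parabolic, `H₂` a field-restriction ("anisotropic") middle of order `≈ p^{3k²/2}`. -/
def AnisotropicSiegelFamily : Prop :=
  ∀ k : ℕ, 1 ≤ k → ∃ c : ℝ, 0 < c ∧ ∀ p₀ : ℕ, ∃ (p : ℕ) (_ : Fact p.Prime), p₀ ≤ p ∧
    ∃ H₁ H₂ H₃ : Subgroup (GLp (2 * k) p), SubgroupTPP H₁ H₂ H₃ ∧
      c * (p : ℝ) ^ ((9 * (k : ℝ) ^ 2 - 2) / 2) ≤ (Nat.card H₁ * Nat.card H₂ * Nat.card H₃ : ℕ) ∧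
      CruxIdTest p (2 * k) k H₁ H₂ H₃

/-- The transfer (ε-bookkeeping, to be proved by the line): given `ε > 0` pick `k` with
`4/(3k-2) < ε/2`, then `p` large; `V^{s/3} ≥ c^{s/3} p^{(3k²/2)s - s/3}` beats
`C^s p^{s(3k²/2 - k/2) + k}` iff `s > 6k/(3k-2)`. -/
theorem subgroupIdentityDesigns_of_siegelFamily (hB : LevelBudgetAsymptotics)
    (hF : AnisotropicSiegelFamily) :
    Summit.MatrixMultiplication.MatrixMultiplication.Theses.LevelGradedCohnUmans.SubgroupIdentityDesigns := by
  sorry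

end Sandwich

/-! ## Card `ghost-calculus-chebotarev`: the identity test as discrete tomography -/

section Ghosts

variable {p : ℕ} [Fact p.Prime]

/-- An `F_k`-GHOST on the product set of the triple: a function supported on `H₁H₂H₃` whose sums over
every frame plane `{g : g U = C}` (`U, C ∈ M_{m×k}(𝔽_p)`) vanish — equivalently (Fourier inversion on
the additive group `M_m(𝔽_p)`) a function on `S` annihilating every level-`k` test function, i.e. whose
additive Fourier transform vanishes on the determinantal variety `{rk ≤ k}`. -/
def IsGhost (p m k : ℕ) [Fact p.Prime] (H₁ H₂ H₃ : Subgroup (GLp m p)) (lam : GLp m p → ℂ) : Prop :=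
  (∀ g, lam g ≠ 0 → ∃ a ∈ H₁, ∃ b ∈ H₂, ∃ c ∈ H₃, g = a * b * c) ∧
  ∀ U C : Matrix (Fin m) (Fin k) (ZMod p),
    (∑ g ∈ Finset.univ.filter (fun g : GLp m p => (g : Mat m p) * U = C), lam g) = 0

/-- FIRST LEMMA (duality; finite-dimensional linear algebra + `F_k = span{1[gU = C]}`):
**the crux's identity test holds iff no ghost passes through the identity.** -/
theorem cruxIdTest_iff_no_ghost (m k : ℕ) (H₁ H₂ H₃ : Subgroup (GLp m p)) :
    CruxIdTest p m k H₁ H₂ H₃ ↔ ¬ ∃ lam : GLp m p → ℂ, lam 1 ≠ 0 ∧ IsGhost p m k H₁ H₂ H₃ lam := by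
  sorry

/-- FIRST LEMMA (k = 1, m = 2, the solved cell): for `H₁ = U⁻`, `H₃ = U⁺` and a middle `H₂ ≤ SL_2(𝔽_p)`
inside the big cell, the level-1 identity test holds IFF the middle shows at most `(p-1)/2` distinct
`(1,1)`-entries.  (⇐: isotypic ghosts along `U⁻ × U⁺` are vectors on `A` = the set of `(1,1)`-entries
killed by the DFT minors `(ψ(w a⁻¹))_{a ∈ A, w ∈ W_{σ,τ}}`, `W_{σ,τ} = {τv - σv⁻¹ : v ≠ 0}`,
`|W_{σ,τ}| ≥ (p-1)/2`, nonsingular by `Literature.Analysis.Fourier.det_dftMinor_ne_zero`; ⇒: for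
`στ` with `-4στ` a non-square `|W_{σ,τ}| = (p-1)/2 < |A|` and Chebotarev again gives a kernel vector
with `φ(1) ≠ 0`.)  The sibling `sandwich_criterion_GL2` is the ⇐ direction with TPP bookkeeping. -/
theorem sandwich_GL2_iff (hp : 5 ≤ p) (H₁ H₂ H₃ : Subgroup (GLp 2 p))
    (h₁ : ∀ a ∈ H₁, (a : Mat 2 p) 0 0 = 1 ∧ (a : Mat 2 p) 1 1 = 1 ∧ (a : Mat 2 p) 0 1 = 0)
    (h₁c : Nat.card H₁ = p)
    (h₃ : ∀ c ∈ H₃, (c : Mat 2 p) 0 0 = 1 ∧ (c : Mat 2 p) 1 1 = 1 ∧ (c : Mat 2 p) 1 0 = 0)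
    (h₃c : Nat.card H₃ = p)
    (hdet : ∀ b ∈ H₂, Matrix.det (b : Mat 2 p) = 1)
    (hcell : ∀ b ∈ H₂, (b : Mat 2 p) 0 0 ≠ 0) :
    CruxIdTest p 2 1 H₁ H₂ H₃ ↔
      2 * Set.ncard ((fun b : GLp 2 p => (b : Mat 2 p) 0 0) '' (H₂ : Set (GLp 2 p))) ≤ p - 1 := by
  sorry

end Ghosts

end Summit.MatrixMultiplication.MatrixMultiplication.Cruxes.SubgroupIdentityDesigns.Ideator1
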